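import Literature.Algebra.EuclideanLattices.GapCVPConstNPHard
import Literature.Algebra.EuclideanLattices.KhotGapInstancesParam
import Literature.Algebra.EuclideanLattices.KhotGapInstance
import Literature.Algebra.EuclideanLattices.KhotMachineFP
import Literature.Algebra.EuclideanLattices.GapInstanceCodeFP
import Literature.Computability.Complexity.PromiseProofs
import Literature.Computability.Complexity.GapSetCoverProofs
import HarnessLib

/-!
# Arora–Babai–Stern–Sweedyk 1997, Thm. 5 (i) for `ℓ₂`: the set-cover → `GapCVP` transformation, proved

Topic `Algebra/EuclideanLattices`, namespace `Literature.Algebra.EuclideanLattices` (construction grouped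
under `ABSS`). Companion of `GapCVPConstNPHard.lean`, which vendors the named fact
`AroraEtAl1997_thm5_gapCVP` ("for any constant `c > 1`, approximating the nearest vector problem within
a factor `c` is NP-hard": (SAT, UNSAT) Karp-reduces to `GapCVP_c` for every rational `c > 1`). This file
PROVES the fact: the transformation of Thm. 5 from its only non-elementary input, Prop. 6 of the paper
(gap exact set cover is NP-hard for every constant factor, Bellare–Goldwasser–Lund–Russell 1993 + the
PCP theorem; the tree's named fact `Literature.Computability.Complexity.AroraEtAl1997_prop6`) —
**`AroraEtAl1997_thm5_gapCVP_of_prop6`** — and, Prop. 6 being discharged in the tree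
(`AroraEtAl1997_prop6_holds`, `GapSetCoverProofs.lean`, on the cone of the proved PCP theorem
`pcp_theorem_exact_holds`), the unconditional **`AroraEtAl1997_thm5_gapCVP_holds`** and
`isNPHard_gapCVPPromise_const` (`GapCVP_c` is NP-hard for every rational `c > 1`). No new facts.

## The source, as printed (JCSS 54 (1997), proof of Thm. 5, p. 320), and the rendering

"Let `(U, S₁, …, S_m), K` be the instance of set-cover obtained in Proposition 6. We transform it to
an instance of `NV₁`, `b₀` and `L(b₁, …, b_m)`, such that the distance of `b₀` to the nearest lattice
point is either `K` or `≥ c·K`. The vectors have `|U| + m` coordinates. Let `L = c·K`. The point `b₀` is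
the vector having `L` in the first `|U|` coordinates, followed by `m` 0's. The `i`th basis vector `bᵢ`
is `(L·χ_{Sᵢ}, 0, …, 0, 1, 0, …, 0)` (the 1 appears in position `|U| + i`) … If there is an exact cover
of size `K`, say `(S_{i₁}, …, S_{i_K})`, then the vector `Σⱼ b_{iⱼ}` has `ℓ₁` distance `K` from `b₀`.
(Note that the exactness of the cover is crucial.) Conversely, suppose no cover has size less than `L` …
Consider, for any integer assignment to the `αᵢ`'s, the collection of subsets `{Sᵢ : αᵢ ≠ 0}`. If these
sets form a set-cover, then `Σ|αᵢ| ≥ L`. If they do not, then one of the coordinates in `-b₀ + Σ αᵢbᵢ`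
is at least `L` … Other finite norms: changing the norm from `ℓ₁` to `ℓ_p` changes the minimum
distances in the two cases to `K^{1/p}` and `(cK)^{1/p}`. Hence to prove the hardness of approximating
`NV_p` within a factor `t`, we just use the reduction described in Proposition 6 with `c = tᵖ`."

Rendering for the tree's `GapCVP` (`Problems.lean`: SQUARE NONSINGULAR integer bases in row convention,
integer targets, a RATIONAL threshold `d > 0`, YES `dist ≤ d`, NO `γ·d < dist` STRICT), `p = 2`, factor
`t = c`:
* (padding, not in the source) the `m` generators `bⱼ = (eⱼ, Q·χ_{Sⱼ})` (set coordinates first) are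
  completed by the `|U|` generators `2Q·e_u`, `u ∈ U`, to the upper block-triangular square basis
  `ABSS.basis = [[1, Q·Incᵀ], [0, 2Q·1]]` of determinant `(2Q)^{|U|}` (`ABSS.det_basis`). The printed NO
  argument survives verbatim (`ABSS.no_core`): a `U`-coordinate of `(y, w)·B - b₀` is
  `Q·((Inc y)_u + 2w_u - 1)`, either a nonzero multiple of `Q` or zero, and in the latter case
  `(Inc y)_u = 1 - 2w_u` is odd, hence nonzero, so `{j : yⱼ ≠ 0}` is still a cover;
* (rounding) the threshold is the integer `D = ⌊√K⌋ + 1` (`K < D² ≤ 4K`, `ABSS.lt_D_sq`, `ABSS.D_sq_le`),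
  the large entry is `Q = G·D` with `G = ⌈c⌉₊ + 1 > c`, and Prop. 6 is invoked at the natural factor
  `4G²` (printed `c = t²`; the `4` absorbs the rounding): YES `dist² = K ≤ D²`, NO
  `dist² ≥ min(Q², 4G²K) > (cD)²` (`ABSS.inst_mem_yes`, `ABSS.inst_mem_no`);
* (guard) instances with `K = 0`, or whose universe has more elements than there are listed set
  members, are never YES instances and are sent to one fixed NO instance (`ABSS.noInst`, the instance of
  the uncoverable system `U = {0}`, `S₀ = {1}`, `K = 1`); this keeps the output dimension `m + |U|`
  polynomial in the code length off the promise (`ABSS.uEff`, `ABSS.guardBit`).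
The machine is assembled in the typed algebra `CodeFP` (`ABSS.reduceFP`: the table by `LMat.tabFP` from
the entry function `ABSS.entry`, the output code by `GapCodes.cvpCode_codeFP`), and the Karp reduction
`gapSetCover (4G²) ≤ₚ GapCVP_c` (`ABSS.gapSetCover_polyTimeReducible_gapCVP`) is composed with Prop. 6 by
`PromiseProblem.PolyTimeReducible.trans_holds`.

## Not here

The `ℓ_p` versions for `p ≠ 2` and "NV₁ with 0/1 vectors", the other problems of Thm. 5 (nearest
codeword, min-unsatisfy, halfspace learning), the large factors of Thm. 8 / §6, and Prop. 6 itself.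

## References

* S. Arora, L. Babai, J. Stern, Z. Sweedyk, *The hardness of approximate optima in lattices, codes,
  and systems of linear equations*, J. Comput. Syst. Sci. 54 (1997) 317–331: Thm. 5 (p. 319), its
  proof (p. 320), Prop. 6 (p. 319) [AroraEtAl1997].
* D. Micciancio, S. Goldwasser, *Complexity of Lattice Problems*, Kluwer 2002, Ch. 1 §1.2 (`GapCVP`;
  codes of instances) [MicciancioGoldwasser2002].
* S. Arora, B. Barak, *Computational Complexity: A Modern Approach*, CUP 2009, §1.3, §2.1
  (polynomial time, Karp reductions) [AroraBarak2009].
-/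

noncomputable section

namespace Literature.Algebra.EuclideanLattices

open Matrix Finset Metric

namespace ABSS

/-! ### The lattice of a set system (p. 320), padded to a square basis -/

section Abstract

variable {U S : Type} [Fintype U] [Fintype S] [DecidableEq U] [DecidableEq S]

/-- **The ABSS generators, padded.** Rows = generators, coordinates = `S ⊕ U` (set coordinates,
then universe coordinates): generator `j ∈ S` is `b_j = (e_j, Q·χ_{S_j})` (printed p. 320:
"`b_i = (L·χ_{S_i}, 0, …, 0, 1, 0, …, 0)`"), and — not in the source, forced by the tree's square
nonsingular `GapCVP` instances — the padding generator `2Q·e_u` for each `u ∈ U`; as a block matrix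
`[[1, Q·Incᵀ], [0, 2Q·1]]`. [cite: AroraEtAl1997, Thm. 5 (proof, p. 320)] -/
def basis (Q : ℤ) (F : S → Finset U) : Matrix (S ⊕ U) (S ⊕ U) ℤ :=
  Matrix.fromBlocks 1 (Q • (Khot.incidence F)ᵀ) 0 ((2 * Q) • 1)

/-- **The ABSS target** `b₀ = (0, Q·1_U)` ("the vector having `L` in the first `|U|` coordinates,
followed by `m` 0's"; here the `U`-block is written second). [cite: AroraEtAl1997, Thm. 5 (proof, p. 320)] -/
def target (Q : ℤ) : S ⊕ U → ℤ :=
  Sum.elim 0 fun _ => Q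

/-- `(y, w)·B = (y, Q·(Inc y) + 2Q·w)`. [cite: AroraEtAl1997, Thm. 5 (proof, p. 320)] -/
theorem vecMul_basis (Q : ℤ) (F : S → Finset U) (y : S → ℤ) (w : U → ℤ) :
    Sum.elim y w ᵥ* basis Q F = Sum.elim y (Q • (Khot.incidence F *ᵥ y) + (2 * Q) • w) := by
  rw [basis, Matrix.vecMul_fromBlocks]
  simp only [Sum.elim_comp_inl, Sum.elim_comp_inr, Matrix.vecMul_one, Matrix.vecMul_zero, add_zero,
    Matrix.vecMul_smul, Matrix.vecMul_transpose]

/-- `(y, w)·B - b₀`: the `S`-block is `y`, the `U`-coordinate `e` is `Q·((Inc y)_e + 2w_e - 1)`.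
[cite: AroraEtAl1997, Thm. 5 (proof, p. 320)] -/
theorem vecMul_basis_sub_target (Q : ℤ) (F : S → Finset U) (y : S → ℤ) (w : U → ℤ) :
    Sum.elim y w ᵥ* basis Q F - target Q =
      Sum.elim y fun e => Q * ((Khot.incidence F *ᵥ y) e + 2 * w e - 1) := by
  rw [vecMul_basis, target]
  funext i
  rcases i with j | e
  · simp
  · simp only [Pi.sub_apply, Sum.elim_inr, Pi.add_apply, Pi.smul_apply, smul_eq_mul]
    ring

/-- `det B = (2Q)^{|U|}` (block upper triangular): the padded basis is nonsingular for `Q ≠ 0`.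
[folklore] -/
theorem det_basis (Q : ℤ) (F : S → Finset U) : (basis Q F).det = (2 * Q) ^ Fintype.card U := by
  rw [basis, Matrix.det_fromBlocks_zero₂₁, Matrix.det_one, one_mul, Matrix.det_smul, Matrix.det_one,
    mul_one]

/-- **YES core** ("if there is an exact cover of size `K`, say `S_{i_1}, …, S_{i_K}`, then the vector
`Σ_j b_{i_j}` has distance `K` from `b₀`; the exactness of the cover is crucial"): for an exact
cover `T` and `y = 1_T`, `w = 0`, the difference `(y, w)·B - b₀` is `(1_T, 0)`.
[cite: AroraEtAl1997, Thm. 5 (proof, p. 320)] -/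
theorem yes_core (Q : ℤ) (F : S → Finset U) (T : Finset S)
    (hT : ∀ e : U, (T.filter fun j => e ∈ F j).card = 1) :
    Sum.elim (Khot.indicator T) (0 : U → ℤ) ᵥ* basis Q F - target Q =
      Sum.elim (Khot.indicator T) (0 : U → ℤ) := by
  rw [vecMul_basis_sub_target]
  congr 1
  funext e
  rw [Khot.incidence_mulVec]
  have : ∑ j ∈ univ.filter (fun j => e ∈ F j), Khot.indicator T j =
      ((T.filter fun j => e ∈ F j).card : ℤ) := by
    simp only [Khot.indicator, Finset.sum_boole, Finset.filter_filter]
    congr 2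
    ext j
    simp [and_comm]
  rw [this, hT e]
  simp

omit [DecidableEq U] in
/-- `‖(1_T, 0)‖² = |T|`. [folklore] -/
theorem intSqNorm_indicator_elim (T : Finset S) :
    intSqNorm (Sum.elim (Khot.indicator T) (0 : U → ℤ)) = T.card := by
  rw [intSqNorm_sum_elim]
  have h1 : intSqNorm (Khot.indicator T) = T.card := by
    unfold intSqNorm Khot.indicator
    simp only [ite_pow, one_pow, zero_pow (two_ne_zero), Finset.sum_boole]
    congr 1
    simp
  rw [h1]
  simp [intSqNorm]

/-- **NO core** ("consider, for any integer assignment to the `αᵢ`'s, the collection `{Sᵢ : αᵢ ≠ 0}`.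
If these sets form a set-cover, then `Σ|αᵢ| ≥ L`. If they do not, then one of the coordinates is at
least `L`"), for the padded basis: every `(y, w)·B - b₀` has either a `U`-coordinate that is a
nonzero multiple of `Q` (squared norm `≥ Q²`) or — all `U`-coordinates vanishing forces
`(Inc y)_e = 1 - 2w_e ≠ 0` for every `e`, so `{j : y_j ≠ 0}` is a cover — at least `d` nonzero
set coordinates (squared norm `≥ d`), provided no `< d` sets cover `U`.
[cite: AroraEtAl1997, Thm. 5 (proof, p. 320)] -/
theorem no_core (Q : ℤ) (F : S → Finset U) {d : ℕ}
    (hNO : ∀ T : Finset S, T.card < d → ∃ e : U, ∀ j ∈ T, e ∉ F j) (y : S → ℤ) (w : U → ℤ) :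
    Q ^ 2 ≤ intSqNorm (Sum.elim y w ᵥ* basis Q F - target Q) ∨
      (d : ℤ) ≤ intSqNorm (Sum.elim y w ᵥ* basis Q F - target Q) := by
  classical
  rw [vecMul_basis_sub_target]
  by_cases h : ∃ e, (Khot.incidence F *ᵥ y) e + 2 * w e - 1 ≠ 0
  · obtain ⟨e, he⟩ := h
    refine Or.inl (le_trans ?_ (sq_le_intSqNorm _ (Sum.inr e)))
    simp only [Sum.elim_inr]
    rw [mul_pow]
    have h1 : 1 ≤ ((Khot.incidence F *ᵥ y) e + 2 * w e - 1) ^ 2 := by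
      have := Int.one_le_abs he
      nlinarith [sq_abs ((Khot.incidence F *ᵥ y) e + 2 * w e - 1)]
    nlinarith [sq_nonneg Q]
  · push Not at h
    refine Or.inr ?_
    -- `{j : y j ≠ 0}` covers the universe, so it has at least `d` elements
    have hcov : d ≤ hammingNorm y := by
      by_contra hlt
      push Not at hlt
      obtain ⟨e, he⟩ := hNO (univ.filter fun j => y j ≠ 0) hlt
      have h0 : (Khot.incidence F *ᵥ y) e = 0 := by
        rw [Khot.incidence_mulVec]
        refine Finset.sum_eq_zero fun j hj => ?_
        by_contra hy
        exact he j (Finset.mem_filter.2 ⟨Finset.mem_univ _, hy⟩) (Finset.mem_filter.1 hj).2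
      have := h e
      rw [h0] at this
      omega
    rw [intSqNorm_sum_elim]
    have h1 : (d : ℤ) ≤ intSqNorm y := le_trans (by exact_mod_cast hcov) (hammingNorm_le_intSqNorm y)
    have h2 := intSqNorm_nonneg (fun e => Q * ((Khot.incidence F *ᵥ y) e + 2 * w e - 1))
    linarith

end Abstract

/-! ### Parameters -/

section Params

/-- The integer gap constant `G = ⌈c⌉₊ + 1 > c` used for the large entries and the set-cover gap
("use the reduction described in Proposition 6 with `c = tᵖ`"). [cite: AroraEtAl1997, Thm. 5 (proof, p. 320)] -/
def G (c : ℚ) : ℕ := ⌈c⌉₊ + 1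

/-- The set-cover gap fed to Prop. 6: `C' = 4G²` (printed: `c = t²` for the `ℓ₂` factor `t`; the
factor `4` absorbs the rounding of the threshold `√K` up to the integer `D`, `K < D² ≤ 4K`).
[cite: AroraEtAl1997, Thm. 5 (proof, p. 320)] -/
def gapConst (c : ℚ) : ℕ := 4 * G c ^ 2

/-- The distance threshold `D = ⌊√K⌋ + 1` (printed: distance `K^{1/p}`; rounded up to an integer,
`K < D² ≤ 4K` for `K ≥ 1`). [cite: AroraEtAl1997, Thm. 5 (proof, p. 320)] -/
def D (K : ℕ) : ℕ := Nat.sqrt K + 1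

/-- The large entry `Q = G·D` (printed `L = c·K`; any `Q > c·D` serves). [cite: AroraEtAl1997, Thm. 5 (proof, p. 320)] -/
def Q (c : ℚ) (K : ℕ) : ℕ := G c * D K

/-- `c < G`. [folklore] -/
theorem lt_G (c : ℚ) : (c : ℝ) < G c := by
  have h : c ≤ (⌈c⌉₊ : ℚ) := Nat.le_ceil c
  have h' : (c : ℝ) ≤ ((⌈c⌉₊ : ℕ) : ℝ) := by exact_mod_cast h
  simp only [G, Nat.cast_add, Nat.cast_one]
  linarith

/-- `1 < gapConst c` (so Prop. 6 applies). [folklore] -/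
theorem one_lt_gapConst (c : ℚ) : (1 : ℚ) < gapConst c := by
  have hG : 1 ≤ G c := Nat.le_add_left 1 _
  have : (1 : ℕ) < gapConst c := by
    unfold gapConst
    nlinarith
  exact_mod_cast this

/-- `K < D²`. [folklore] -/
theorem lt_D_sq (K : ℕ) : K < D K ^ 2 := by
  rw [D, pow_two]
  exact Nat.succ_le_succ_sqrt K

/-- `D² ≤ 4K` for `K ≥ 1`. [folklore] -/
theorem D_sq_le (K : ℕ) (hK : 1 ≤ K) : D K ^ 2 ≤ 4 * K := by
  have h1 : Nat.sqrt K * Nat.sqrt K ≤ K := Nat.sqrt_le K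
  have h2 : Nat.sqrt K ≤ K := Nat.sqrt_le_self K
  rw [D, pow_two]
  nlinarith

end Params

/-! ### The instance as a list matrix -/

section Lists

open Literature.Computability.Complexity.LMat

/-- **Entry `(i, j)` of the square table** of the padded ABSS basis for `m` sets and the universe
placed after them: rows `i < m` are the generators `b_i = (e_i, Q·χ_{S_i})`, rows `i ≥ m` the
padding generators `2Q·e_{i}`. [cite: AroraEtAl1997, Thm. 5 (proof, p. 320)] -/
def entry (sets : List (List ℕ)) (m : ℕ) (Q : ℤ) (i j : ℕ) : ℤ :=
  if i < m then (if j < m then (if i = j then 1 else 0) else (if j - m ∈ sets.getD i [] then Q else 0))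
  else (if j < m then 0 else (if i = j then 2 * Q else 0))

/-- The square table of the padded ABSS basis (`m + u` rows and columns). [cite: AroraEtAl1997, Thm. 5 (proof, p. 320)] -/
def rows (u : ℕ) (sets : List (List ℕ)) (Q : ℤ) : List (List ℤ) :=
  tab (sets.length + u) (sets.length + u) (entry sets sets.length Q)

/-- The target as a list: `0` on the `m` set coordinates, `Q` on the `u` universe coordinates.
[cite: AroraEtAl1997, Thm. 5 (proof, p. 320)] -/
def targetList (u m : ℕ) (Q : ℤ) : List ℤ :=
  (List.range (m + u)).map fun j => if j < m then 0 else Q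

/-- The set system `j ↦ {e < u : e ∈ S_j}` of a list of sets (members `≥ u` ignored, as in
`SetCoverInstance.IsCover`; equal to `Khot.setSystem ⟨u, sets, K⟩`). [cite: AroraEtAl1997, Prop. 6 (p. 319)] -/
def family (u : ℕ) (sets : List (List ℕ)) : Fin sets.length → Finset (Fin u) :=
  fun j => univ.filter fun e => (e : ℕ) ∈ sets.getD j []

/-- **The table is the padded ABSS basis, reindexed** along `Fin m ⊕ Fin u ≃ Fin (m + u)`.
[cite: AroraEtAl1997, Thm. 5 (proof, p. 320)] -/
theorem entry_finSumFinEquiv (u : ℕ) (sets : List (List ℕ)) (Q : ℤ) (a b : Fin sets.length ⊕ Fin u) :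
    entry sets sets.length Q (finSumFinEquiv a) (finSumFinEquiv b) = basis Q (family u sets) a b := by
  rcases a with i | k <;> rcases b with j | l
  · simp [entry, basis, Matrix.one_apply, Fin.ext_iff]
  · simp [entry, basis, Khot.incidence, family]
  · simp [entry, basis]
  · simp only [entry, basis, finSumFinEquiv_apply_right, Fin.val_natAdd, add_lt_iff_neg_left,
      Nat.not_lt_zero, if_false, Matrix.fromBlocks_apply₂₂, Matrix.smul_apply, Matrix.one_apply,
      smul_eq_mul, mul_ite, mul_one, mul_zero, add_right_inj, Fin.ext_iff]

/-- `toMat` of the table is the reindexed padded basis. [cite: AroraEtAl1997, Thm. 5 (proof, p. 320)] -/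
theorem toMat_rows (u : ℕ) (sets : List (List ℕ)) (Q : ℤ) :
    toMat (sets.length + u) (sets.length + u) (rows u sets Q) =
      Matrix.reindex finSumFinEquiv finSumFinEquiv (basis Q (family u sets)) := by
  funext i j
  rw [rows, toMat_tab, Matrix.reindex_apply, Matrix.submatrix_apply]
  have h := entry_finSumFinEquiv u sets Q (finSumFinEquiv.symm i) (finSumFinEquiv.symm j)
  simp only [Equiv.apply_symm_apply] at h
  exact h

/-- The target list has length `m + u`. [folklore] -/
theorem length_targetList (u m : ℕ) (Q : ℤ) : (targetList u m Q).length = m + u := by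
  simp [targetList]

/-- The target read as a vector is the reindexed ABSS target. [cite: AroraEtAl1997, Thm. 5 (proof, p. 320)] -/
theorem targetList_getD (u m : ℕ) (Q : ℤ) (a : Fin m ⊕ Fin u) :
    (targetList u m Q).getD (finSumFinEquiv a) 0 = target Q a := by
  rcases a with j | k
  · rw [targetList, getD_map_range _ (by simp; omega)]
    simp [target]
  · rw [targetList, getD_map_range _ (by simp)]
    simp [target]

end Lists

/-! ### The `GapCVP` instance of a set-cover instance and its YES/NO behaviour -/

section Instance

open Literature.Computability.Complexity Literature.Computability.Complexity.LMat

/-- Membership in `family u sets j`. [folklore] -/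
@[simp] theorem mem_family (u : ℕ) (sets : List (List ℕ)) (j : Fin sets.length) (e : Fin u) :
    e ∈ family u sets j ↔ (e : ℕ) ∈ sets.getD j [] := by
  simp [family]

/-- `Khot.setSystem` is `family` (definitional). [folklore] -/
theorem setSystem_eq_family (I : SetCoverInstance) : Khot.setSystem I = family I.univSize I.sets := rfl

/-- **NO instances of `gapSetCover C` for a natural `C`**, in the form of `no_core`: fewer than
`C·K` of the sets never cover the universe. (The tree's `Khot.noCover_of_mem_noSet` is the case
`C = 40`.) [cite: AroraEtAl1997, Prop. 6 (p. 319)] -/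
theorem noCover_of_mem_noSet {C : ℕ} {I : SetCoverInstance} (h : I ∈ GapSetCover.noSet (C : ℚ)) :
    ∀ T₀ : Finset (Fin I.sets.length), T₀.card < C * I.K →
      ∃ e : Fin I.univSize, ∀ j ∈ T₀, e ∉ family I.univSize I.sets j := by
  classical
  intro T₀ hcard
  by_contra hcov
  push Not at hcov
  have hcover : I.IsCover (T₀.map Fin.valEmbedding) := by
    refine ⟨fun j hj => ?_, fun e he => ?_⟩
    · obtain ⟨j', -, rfl⟩ := mem_map.1 hj
      exact j'.2
    · obtain ⟨j, hjT, hje⟩ := hcov ⟨e, he⟩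
      exact ⟨j, mem_map_of_mem _ hjT, (mem_family I.univSize I.sets j ⟨e, he⟩).1 hje⟩
  have hle := h _ hcover
  rw [card_map] at hle
  have hlt : (T₀.card : ℚ) < C * I.K := by exact_mod_cast hcard
  have : (C : ℚ) * I.K ≤ T₀.card := by exact_mod_cast hle
  linarith

/-- **The `GapCVP_c` instance of Thm. 5** assigned to the set-cover data `(u, S₀, …, S_{m-1}, K)`:
the lattice of the padded ABSS basis in dimension `m + u`, the target `(0, Q·1_U)` and the threshold
`D`. [cite: AroraEtAl1997, Thm. 5 (proof, p. 320)] -/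
def inst (c : ℚ) (u : ℕ) (sets : List (List ℕ)) (K : ℕ) : GapCVPInstance :=
  (⟨⟨sets.length + u, toMat (sets.length + u) (sets.length + u) (rows u sets (Q c K))⟩,
    fun j => (targetList u sets.length (Q c K)).getD j 0⟩, (D K : ℚ))

/-- `0 < Q`. [folklore] -/
theorem Q_pos (c : ℚ) (K : ℕ) : 0 < Q c K := Nat.mul_pos (Nat.succ_pos _) (Nat.succ_pos _)

/-- The instance is nonsingular (`det = (2Q)^u ≠ 0`). [folklore] -/
theorem inst_isNonsingular (c : ℚ) (u : ℕ) (sets : List (List ℕ)) (K : ℕ) :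
    (inst c u sets K).1.I.IsNonsingular := by
  show (toMat (sets.length + u) (sets.length + u) (rows u sets (Q c K))).det ≠ 0
  rw [toMat_rows, Matrix.det_reindex_self, det_basis]
  refine pow_ne_zero _ (mul_ne_zero two_ne_zero ?_)
  exact_mod_cast (Q_pos c K).ne'

/-- **The squared distance from the target to a lattice point is the integer squared norm of the
abstract difference vector** `(y, w)·B - b₀` with `(y, w) = z ∘ finSumFinEquiv`.
[cite: AroraEtAl1997, Thm. 5 (proof, p. 320)] -/
theorem dist_ofCoeffs_sq (c : ℚ) (u : ℕ) (sets : List (List ℕ)) (K : ℕ)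
    (z : Fin (sets.length + u) → ℤ) :
    dist (inst c u sets K).1.targetE ((inst c u sets K).1.I.ofCoeffs z) ^ 2 =
      (intSqNorm (Sum.elim (z ∘ finSumFinEquiv ∘ Sum.inl) (z ∘ finSumFinEquiv ∘ Sum.inr) ᵥ*
          basis (Q c K : ℤ) (family u sets) - target (Q c K : ℤ)) : ℝ) := by
  have htI : (fun j : Fin (sets.length + u) => (targetList u sets.length (Q c K : ℤ)).getD j 0) =
      target (Q c K : ℤ) ∘ finSumFinEquiv.symm := by
    funext j
    have := targetList_getD u sets.length (Q c K : ℤ) (finSumFinEquiv.symm j)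
    simp only [Equiv.apply_symm_apply] at this
    exact this
  have hvec : z ᵥ* toMat (sets.length + u) (sets.length + u) (rows u sets (Q c K)) =
      ((z ∘ finSumFinEquiv) ᵥ* basis (Q c K : ℤ) (family u sets)) ∘ finSumFinEquiv.symm := by
    rw [toMat_rows, Matrix.reindex_apply, Matrix.submatrix_vecMul_equiv]
    simp
  have hdiff : z ᵥ* toMat (sets.length + u) (sets.length + u) (rows u sets (Q c K)) -
      (fun j : Fin (sets.length + u) => (targetList u sets.length (Q c K : ℤ)).getD j 0) =
      ((z ∘ finSumFinEquiv) ᵥ* basis (Q c K : ℤ) (family u sets) - target (Q c K : ℤ)) ∘ finSumFinEquiv.symm := by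
    rw [hvec, htI]
    rfl
  have hze : z ∘ finSumFinEquiv = Sum.elim (z ∘ finSumFinEquiv ∘ Sum.inl) (z ∘ finSumFinEquiv ∘ Sum.inr) := by
    funext a
    rcases a with j | k <;> rfl
  rw [dist_comm, dist_eq_norm]
  show ‖intVecToEuclidean (sets.length + u) (z ᵥ* toMat (sets.length + u) (sets.length + u) (rows u sets (Q c K))) -
      intVecToEuclidean (sets.length + u) (fun j => (targetList u sets.length (Q c K : ℤ)).getD j 0)‖ ^ 2 = _
  rw [← map_sub, norm_intVecToEuclidean_sq, hdiff, intSqNorm_comp_equiv, ← hze]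

/-- The threshold of the instance is `D`, also as a real number. [folklore] -/
theorem inst_threshold (c : ℚ) (u : ℕ) (sets : List (List ℕ)) (K : ℕ) :
    (((inst c u sets K).2 : ℚ) : ℝ) = (D K : ℝ) := by
  show (((D K : ℕ) : ℚ) : ℝ) = (D K : ℝ)
  norm_cast

/-- The threshold is positive. [folklore] -/
theorem inst_threshold_pos (c : ℚ) (u : ℕ) (sets : List (List ℕ)) (K : ℕ) : 0 < (inst c u sets K).2 := by
  show (0 : ℚ) < (D K : ℕ)
  exact_mod_cast Nat.succ_pos _

/-- **YES ↦ YES** ("if there is an exact cover of size `K` … the vector `Σ b_{i_j}` has distance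
`K^{1/p}` from `b₀`"): an exact cover of size `K ≥ 1` gives a lattice point at distance `√K ≤ D`, so
the instance is a YES instance of `GapCVP_γ` (any `γ`). [cite: AroraEtAl1997, Thm. 5 (proof, p. 320)] -/
theorem inst_mem_yes (c : ℚ) (γ : ℕ → ℝ) {I : SetCoverInstance} (hI : I ∈ GapSetCover.yesSet) :
    inst c I.univSize I.sets I.K ∈ GapCVP.yes γ := by
  classical
  obtain ⟨-, T₀, hT₀card, hT₀ex⟩ := Khot.exactCover_of_mem_yesSet hI
  rw [setSystem_eq_family] at hT₀ex
  refine ⟨inst_isNonsingular c _ _ _, inst_threshold_pos c _ _ _, ?_⟩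
  let z : Fin (I.sets.length + I.univSize) → ℤ :=
    Sum.elim (Khot.indicator T₀) (0 : Fin I.univSize → ℤ) ∘ finSumFinEquiv.symm
  have hmem := (inst c I.univSize I.sets I.K).1.I.ofCoeffs_mem_lattice z
  have hsq := dist_ofCoeffs_sq c I.univSize I.sets I.K z
  have hze : Sum.elim (z ∘ finSumFinEquiv ∘ Sum.inl) (z ∘ finSumFinEquiv ∘ Sum.inr) =
      Sum.elim (Khot.indicator T₀) (0 : Fin I.univSize → ℤ) := by
    funext a
    rcases a with j | k <;> simp [z]
  rw [hze, yes_core _ _ _ hT₀ex, intSqNorm_indicator_elim, hT₀card] at hsq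
  have hK : ((I.K : ℤ) : ℝ) ≤ (D I.K : ℝ) ^ 2 := by
    have := (lt_D_sq I.K).le
    exact_mod_cast this
  have hgoal : dist (inst c I.univSize I.sets I.K).1.targetE ((inst c I.univSize I.sets I.K).1.I.ofCoeffs z) ≤ D I.K :=
    calc dist (inst c I.univSize I.sets I.K).1.targetE ((inst c I.univSize I.sets I.K).1.I.ofCoeffs z)
        = Real.sqrt (dist (inst c I.univSize I.sets I.K).1.targetE ((inst c I.univSize I.sets I.K).1.I.ofCoeffs z) ^ 2) :=
          (Real.sqrt_sq dist_nonneg).symm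
      _ ≤ Real.sqrt ((D I.K : ℝ) ^ 2) := Real.sqrt_le_sqrt (hsq ▸ hK)
      _ = D I.K := Real.sqrt_sq (Nat.cast_nonneg _)
  exact (infDist_le_dist_of_mem hmem).trans (hgoal.trans_eq (inst_threshold c _ _ _).symm)

/-- **NO ↦ NO** ("conversely, suppose no cover has size less than `L` … in any case
`‖b₀ + Σ αᵢ bᵢ‖ ≥ L`"): if every cover has size `≥ 4G²·K` and `K ≥ 1`, every lattice point is at
squared distance `≥ min(Q², 4G²K) > (c·D)²` from the target, so the instance is a NO instance of
`GapCVP_c`. [cite: AroraEtAl1997, Thm. 5 (proof, p. 320)] -/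
theorem inst_mem_no {c : ℚ} (hc : 1 < c) {I : SetCoverInstance}
    (hI : I ∈ GapSetCover.noSet (gapConst c : ℚ)) (hK : 1 ≤ I.K) :
    inst c I.univSize I.sets I.K ∈ GapCVP.no fun _ => (c : ℝ) := by
  classical
  have hNO := noCover_of_mem_noSet hI
  refine ⟨inst_isNonsingular c _ _ _, inst_threshold_pos c _ _ _, ?_⟩
  -- the integer lower bound on all squared distances
  have hb : ∀ z : Fin (I.sets.length + I.univSize) → ℤ,
      ((min ((Q c I.K : ℤ) ^ 2) ((gapConst c * I.K : ℕ) : ℤ) : ℤ) : ℝ) ≤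
        dist (inst c I.univSize I.sets I.K).1.targetE ((inst c I.univSize I.sets I.K).1.I.ofCoeffs z) ^ 2 := by
    intro z
    rw [dist_ofCoeffs_sq]
    have h := no_core (Q c I.K : ℤ) (family I.univSize I.sets) hNO
      (z ∘ finSumFinEquiv ∘ Sum.inl) (z ∘ finSumFinEquiv ∘ Sum.inr)
    have : min ((Q c I.K : ℤ) ^ 2) ((gapConst c * I.K : ℕ) : ℤ) ≤
        intSqNorm (Sum.elim (z ∘ finSumFinEquiv ∘ Sum.inl) (z ∘ finSumFinEquiv ∘ Sum.inr) ᵥ*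
          basis (Q c I.K : ℤ) (family I.univSize I.sets) - target (Q c I.K : ℤ)) := by
      rcases h with h | h
      · exact (min_le_left _ _).trans h
      · exact (min_le_right _ _).trans (by exact_mod_cast h)
    exact_mod_cast this
  -- `(c·D)² < min(Q², 4G²K)`
  have hcG := lt_G c
  have hc0 : (0 : ℝ) < c := by exact_mod_cast (one_pos.trans hc)
  have hD0 : (0 : ℝ) < D I.K := by exact_mod_cast Nat.succ_pos _
  have hD2 : (D I.K : ℝ) ^ 2 ≤ 4 * I.K := by exact_mod_cast D_sq_le I.K hK
  have hlt : ((c : ℝ) * D I.K) ^ 2 < ((min ((Q c I.K : ℤ) ^ 2) ((gapConst c * I.K : ℕ) : ℤ) : ℤ) : ℝ) := by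
    have h1 : ((c : ℝ) * D I.K) ^ 2 < (((Q c I.K : ℕ) : ℤ) : ℝ) ^ 2 := by
      have hQ : (((Q c I.K : ℕ) : ℤ) : ℝ) = (G c : ℝ) * D I.K := by
        rw [Q]
        norm_cast
      rw [hQ]
      exact pow_lt_pow_left₀ (mul_lt_mul_of_pos_right hcG hD0) (by positivity) two_ne_zero
    have h2 : ((c : ℝ) * D I.K) ^ 2 < (((gapConst c * I.K : ℕ) : ℤ) : ℝ) := by
      have hC : (((gapConst c * I.K : ℕ) : ℤ) : ℝ) = 4 * (G c : ℝ) ^ 2 * I.K := by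
        rw [gapConst]
        norm_cast
      rw [hC]
      have hcG2 : (c : ℝ) ^ 2 < (G c : ℝ) ^ 2 := pow_lt_pow_left₀ hcG hc0.le two_ne_zero
      have hK0 : (0 : ℝ) < 4 * I.K := by
        have : (1 : ℝ) ≤ I.K := by exact_mod_cast hK
        linarith
      calc ((c : ℝ) * D I.K) ^ 2 = (c : ℝ) ^ 2 * (D I.K : ℝ) ^ 2 := by ring
        _ ≤ (c : ℝ) ^ 2 * (4 * I.K) := by gcongr
        _ < (G c : ℝ) ^ 2 * (4 * I.K) := mul_lt_mul_of_pos_right hcG2 hK0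
        _ = 4 * (G c : ℝ) ^ 2 * I.K := by ring
    rw [Int.cast_min]
    exact lt_min (by exact_mod_cast h1) h2
  -- conclude: `c·D < √min ≤ dist(t, v)` for every lattice point `v`
  have hsqrt : (c : ℝ) * D I.K < Real.sqrt (((min ((Q c I.K : ℤ) ^ 2) ((gapConst c * I.K : ℕ) : ℤ) : ℤ) : ℝ)) :=
    (Real.lt_sqrt (by positivity)).2 hlt
  have hle : Real.sqrt (((min ((Q c I.K : ℤ) ^ 2) ((gapConst c * I.K : ℕ) : ℤ) : ℤ) : ℝ)) ≤
      infDist (inst c I.univSize I.sets I.K).1.targetE (inst c I.univSize I.sets I.K).1.I.lattice := by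
    by_contra hlt'
    push Not at hlt'
    obtain ⟨x, hx, hxlt⟩ := (infDist_lt_iff ⟨0, Submodule.zero_mem _⟩).1 hlt'
    obtain ⟨z, rfl⟩ := ((inst c I.univSize I.sets I.K).1.I.mem_lattice_iff x).1 hx
    have h := (Real.sqrt_le_sqrt (hb z)).trans_eq (Real.sqrt_sq dist_nonneg)
    linarith
  show (c : ℝ) * (((inst c I.univSize I.sets I.K).2 : ℚ) : ℝ) < _
  rw [inst_threshold]
  exact hsqrt.trans_le hle

end Instance

/-! ### The reduction on codes: the guard, the fixed NO instance, the output string -/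

section Machine

open _root_.Computability Literature.Computability.Complexity Literature.Computability.Complexity.CodeFP
  Literature.Computability.Complexity.LMat

/-- The effective universe size `min u T`, `T` the total number of listed elements (equal to `u` on
the guard; keeps the output dimension polynomial in the code length off the promise). [folklore] -/
def uEff (I : SetCoverInstance) : ℕ := min I.univSize I.sets.flatten.length

/-- **The guard**: `1 ≤ K` and `u ≤ T`. Instances failing it are never YES instances (an exact cover
needs `K ≥ 1` by definition of `GapSetCover.yesSet`, and a covered universe has at most `T`
elements), so the reduction may send them to a fixed NO instance. [folklore] -/
def guardBit (I : SetCoverInstance) : Bool :=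
  decide (1 ≤ I.K) && decide (I.univSize ≤ I.sets.flatten.length)

/-- A fixed set-cover instance that is a NO instance for every factor: universe `{0}`, one set `{1}`
(which misses `0`), `K = 1` — there is no cover at all. [folklore] -/
def noCoverInstance : SetCoverInstance := ⟨1, [[1]], 1⟩

/-- `noCoverInstance` is a NO instance of `gapSetCover C` for every `C`. [folklore] -/
theorem noCoverInstance_mem_noSet (C : ℚ) : noCoverInstance ∈ GapSetCover.noSet C := by
  intro T hT
  exfalso
  obtain ⟨j, hj, hmem⟩ := hT.2 0 (by decide)
  have hj1 : j < 1 := hT.1 j hj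
  have hj0 : j = 0 := by omega
  subst hj0
  simp [noCoverInstance, SetCoverInstance.subsetAt] at hmem

/-- **The fixed NO instance of `GapCVP_c`**: the instance of Thm. 5 for `noCoverInstance`.
[cite: AroraEtAl1997, Thm. 5 (proof, p. 320)] -/
def noInst (c : ℚ) : GapCVPInstance := inst c 1 [[1]] 1

/-- `noInst c` is a NO instance of `GapCVP_c` for `c > 1`. [cite: AroraEtAl1997, Thm. 5 (proof, p. 320)] -/
theorem noInst_mem_no {c : ℚ} (hc : 1 < c) : noInst c ∈ GapCVP.no fun _ => (c : ℝ) :=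
  inst_mem_no (I := noCoverInstance) hc (noCoverInstance_mem_noSet _) le_rfl

/-- **The output of the reduction** on (the code of) a set-cover instance: on the guard, the code of
the `GapCVP_c` instance of Thm. 5 (written by `GapCodes.cvpCode` from the table, the target list and
the threshold `D/1`); off the guard, the code of the fixed NO instance.
[cite: AroraEtAl1997, Thm. 5 (proof, p. 320)] -/
def reduce (c : ℚ) (I : SetCoverInstance) : List Bool :=
  if guardBit I then
    GapCodes.cvpCode (I.sets.length + uEff I) (rows (uEff I) I.sets (Q c I.K))
      (targetList (uEff I) I.sets.length (Q c I.K)) (D I.K : ℤ) 1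
  else GapCVPInstance.encode (noInst c)

/-- YES instances pass the guard (`K ≥ 1`; every element of the universe is listed, so `u ≤ T`).
[cite: AroraEtAl1997, Prop. 6 (p. 319)] -/
theorem guardBit_of_mem_yesSet {I : SetCoverInstance} (hI : I ∈ GapSetCover.yesSet) : guardBit I = true := by
  obtain ⟨hK, T, hT, -⟩ := hI
  have hcov := hT.isCover
  have hu : I.univSize ≤ I.sets.flatten.length :=
    Khot.univSize_le_of_cover fun e he => by
      obtain ⟨j, hj, hej⟩ := hcov.2 e he
      exact ⟨j, hcov.1 j hj, hej⟩
  simp only [guardBit, Bool.and_eq_true, decide_eq_true_eq]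
  exact ⟨hK, hu⟩

/-- On the guard, `K ≥ 1` and the effective universe is the universe. [folklore] -/
theorem of_guardBit {I : SetCoverInstance} (h : guardBit I = true) : 1 ≤ I.K ∧ uEff I = I.univSize := by
  simp only [guardBit, Bool.and_eq_true, decide_eq_true_eq] at h
  exact ⟨h.1, min_eq_left h.2⟩

/-- The target list is the `ofFn` list of the target vector read off it. [folklore] -/
theorem ofFn_getD_targetList (u m : ℕ) (Q : ℤ) :
    List.ofFn (fun j : Fin (m + u) => (targetList u m Q).getD j 0) = targetList u m Q := by
  refine List.ext_getElem (by simp [length_targetList]) fun i h₁ h₂ => ?_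
  rw [List.getElem_ofFn, List.getD_eq_getElem?_getD, List.getElem?_eq_getElem h₂, Option.getD_some]

/-- **On the guard, the output is the code of the instance of Thm. 5.** [cite: AroraEtAl1997, Thm. 5 (proof, p. 320)] -/
theorem reduce_of_guardBit (c : ℚ) {I : SetCoverInstance} (h : guardBit I = true) :
    reduce c I = GapCVPInstance.encode (inst c I.univSize I.sets I.K) := by
  rw [reduce, if_pos h, (of_guardBit h).2]
  have hcode := GapCodes.cvpCode_eq_encode (I.sets.length + I.univSize) (rows I.univSize I.sets (Q c I.K))
    (fun j => (targetList I.univSize I.sets.length (Q c I.K)).getD j 0) (D I.K : ℚ)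
  rw [ofFn_getD_targetList, Rat.num_natCast, Rat.den_natCast] at hcode
  exact hcode

/-- Off the guard, the output is the code of the fixed NO instance. [folklore] -/
theorem reduce_of_not_guardBit (c : ℚ) {I : SetCoverInstance} (h : ¬guardBit I = true) :
    reduce c I = GapCVPInstance.encode (noInst c) := by
  rw [reduce, if_neg h]

/-! ### Polynomial time -/

/-- The typed view `(u, (sets, K))` is read off the instance code by the identity. [folklore] -/
theorem tupFP : CodeFP SetCoverInstance.encoding.encode (pairE natE (pairE (listE (listE natE)) natE))
    (fun I => (I.univSize, (I.sets, I.K))) :=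
  (CodeFP.id SetCoverInstance.encoding.encode).recodeOut Khot.encode_eq_tE

/-- The list of sets, as a raw list of raw lists, from the code. [folklore] -/
theorem setsFP : CodeFP SetCoverInstance.encoding.encode (rawE (rawE natE)) (fun I => I.sets) := by
  have h := ((map₀ (rawOfList natE)).comp ((rawOfList (listE natE)).comp tupFP.snd'.fst') :)
  exact h.congr fun I => by simp

/-- **The entry function is computed on codes** (context `(sets, (m, Q))`, item `(i, j)`).
[cite: AroraBarak2009, §1.3] -/
theorem entryFP : CodeFP (pairE (pairE (rawE (rawE natE)) (pairE natE intE)) (pairE natE natE)) intE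
    (fun p => entry p.1.1 p.1.2.1 p.1.2.2 p.2.1 p.2.2) := by
  have psets : CodeFP (pairE (pairE (rawE (rawE natE)) (pairE natE intE)) (pairE natE natE)) (rawE (rawE natE))
      (fun p => p.1.1) := (fst _ _).fst'
  have pm : CodeFP (pairE (pairE (rawE (rawE natE)) (pairE natE intE)) (pairE natE natE)) natE
      (fun p => p.1.2.1) := (fst _ _).snd'.fst'
  have pQ : CodeFP (pairE (pairE (rawE (rawE natE)) (pairE natE intE)) (pairE natE natE)) intE
      (fun p => p.1.2.2) := (fst _ _).snd'.snd'
  have pi : CodeFP (pairE (pairE (rawE (rawE natE)) (pairE natE intE)) (pairE natE natE)) natE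
      (fun p => p.2.1) := (snd _ _).fst'
  have pj : CodeFP (pairE (pairE (rawE (rawE natE)) (pairE natE intE)) (pairE natE natE)) natE
      (fun p => p.2.2) := (snd _ _).snd'
  have him := (natLt.comp (pi.pair pm) :)
  have hjm := (natLt.comp (pj.pair pm) :)
  have hij := (natEq.comp (pi.pair pj) :)
  have hrow : CodeFP (pairE (pairE (rawE (rawE natE)) (pairE natE intE)) (pairE natE natE)) (rawE natE)
      (fun p => p.1.1.getD p.2.1 []) := ((rawGetD (rawE natE) (d := ([] : List ℕ)) rfl).comp (psets.pair pi) :)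
  have hmem := ((mem natE_injective).comp ((natSub.comp (pj.pair pm)).pair hrow) :)
  have h2Q := (intMul.comp ((const _ (2 : ℤ)).pair pQ) :)
  have h := him.ite (hjm.ite (hij.ite (const _ (1 : ℤ)) (const _ (0 : ℤ))) (hmem.ite pQ (const _ (0 : ℤ))))
    (hjm.ite (const _ (0 : ℤ)) (hij.ite h2Q (const _ (0 : ℤ))))
  exact h.congr fun p => by simp only [entry, decide_eq_true_eq]

/-- **The reduction is computed on codes by a polynomial-time string function.**
[cite: AroraEtAl1997, Thm. 5 (proof, p. 320); AroraBarak2009, §1.3] -/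
theorem reduceFP (c : ℚ) : CodeFP SetCoverInstance.encoding.encode strE (reduce c) := by
  have hu : CodeFP SetCoverInstance.encoding.encode natE (fun I => I.univSize) := (tupFP.fst' :)
  have hK : CodeFP SetCoverInstance.encoding.encode natE (fun I => I.K) := (tupFP.snd'.snd' :)
  have hsets := setsFP
  have hm : CodeFP SetCoverInstance.encoding.encode natE (fun I => I.sets.length) := ((natLength _).comp hsets :)
  have hmU : CodeFP SetCoverInstance.encoding.encode unE (fun I => I.sets.length) := ((ulength _).comp hsets :)
  have hT : CodeFP SetCoverInstance.encoding.encode unE (fun I => I.sets.flatten.length) :=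
    ((ulength natE).comp ((flatten natE).comp hsets) :)
  have huU : CodeFP SetCoverInstance.encoding.encode unE uEff := (unOfNatMin.comp (hT.pair hu) :)
  have hn : CodeFP SetCoverInstance.encoding.encode unE (fun I => I.sets.length + uEff I) := (unAdd.comp (hmU.pair huU) :)
  have hD : CodeFP SetCoverInstance.encoding.encode natE (fun I => D I.K) :=
    (natAdd.comp ((natSqrt.comp hK).pair (const _ 1)) :)
  have hQ : CodeFP SetCoverInstance.encoding.encode intE (fun I => (Q c I.K : ℤ)) :=
    ((intOfNat.comp (natMul.comp ((const _ (G c)).pair hD)) :).congr fun I => by simp [Q])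
  -- the table
  have hctx : CodeFP SetCoverInstance.encoding.encode (pairE (rawE (rawE natE)) (pairE natE intE))
      (fun I => (I.sets, (I.sets.length, (Q c I.K : ℤ)))) := hsets.pair (hm.pair hQ)
  have hrows : CodeFP SetCoverInstance.encoding.encode matE (fun I => rows (uEff I) I.sets (Q c I.K)) :=
    ((tabFP entryFP).comp (hctx.pair (hn.pair hn)) :).congr fun I => rfl
  -- the target list
  have hitem : CodeFP (pairE (pairE natE intE) natE) intE (fun q => if decide (q.2 < q.1.1) then (0 : ℤ) else q.1.2) :=
    (natLt.comp ((snd _ _).pair (fst _ _).fst')).ite (const _ (0 : ℤ)) (fst _ _).snd'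
  have hxs : CodeFP SetCoverInstance.encoding.encode (rawE intE) (fun I => targetList (uEff I) I.sets.length (Q c I.K)) :=
    (((map hitem).comp ((hm.pair hQ).pair (urange.comp hn)) :).congr fun I => by
      simp only [targetList, decide_eq_true_eq])
  -- the output code on the guard
  have hcode : CodeFP SetCoverInstance.encoding.encode strE (fun I =>
      GapCodes.cvpCode (I.sets.length + uEff I) (rows (uEff I) I.sets (Q c I.K))
        (targetList (uEff I) I.sets.length (Q c I.K)) (D I.K : ℤ) 1) :=
    (GapCodes.cvpCode_codeFP.comp (((hn.pair hrows).pair hxs).pair ((intOfNat.comp hD).pair (const _ 1))) :)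
  -- the guard and the branch
  have hguard : CodeFP SetCoverInstance.encoding.encode bitE guardBit :=
    ((natLe.comp ((const _ 1).pair hK)).and (natLeUn.comp (hu.pair hT)) :)
  exact (hguard.ite hcode (const _ (GapCVPInstance.encode (noInst c)))).congr fun I => rfl

/-! ### The Karp reductions -/

/-- **`gapSetCover (4G²) ≤ₚ GapCVP_c`** — the transformation of Thm. 5 as a Karp reduction of
promise problems (YES ↦ YES by `inst_mem_yes`, NO ↦ NO by `inst_mem_no` / the fixed NO instance,
polynomial time by `reduceFP`). [cite: AroraEtAl1997, Thm. 5 (proof, p. 320)] -/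
theorem gapSetCover_polyTimeReducible_gapCVP {c : ℚ} (hc : 1 < c) :
    (gapSetCover (gapConst c : ℚ)).PolyTimeReducible (gapCVPPromise fun _ => (c : ℝ)) := by
  obtain ⟨f, hf, hfI⟩ := reduceFP c
  refine ⟨f, hf, ?_, ?_⟩
  · intro x hx
    rw [gapSetCover_yes] at hx
    obtain ⟨I, hI, rfl⟩ := hx
    rw [hfI]
    show reduce c I ∈ GapCVPInstance.encode '' GapCVP.yes (fun _ => (c : ℝ))
    rw [reduce_of_guardBit c (guardBit_of_mem_yesSet hI)]
    exact ⟨_, inst_mem_yes c _ hI, rfl⟩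
  · intro x hx
    rw [gapSetCover_no] at hx
    obtain ⟨I, hI, rfl⟩ := hx
    rw [hfI]
    show reduce c I ∈ GapCVPInstance.encode '' GapCVP.no (fun _ => (c : ℝ))
    by_cases hg : guardBit I = true
    · rw [reduce_of_guardBit c hg]
      exact ⟨_, inst_mem_no hc hI (of_guardBit hg).1, rfl⟩
    · rw [reduce_of_not_guardBit c hg]
      exact ⟨_, noInst_mem_no hc, rfl⟩

end Machine

end ABSS

/-- **Arora–Babai–Stern–Sweedyk 1997, Thm. 5 (i) for `ℓ₂`, from Prop. 6**: given the gap
set-cover hardness `AroraEtAl1997_prop6` (Bellare–Goldwasser–Lund–Russell; the PCP-based input,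
the tree's one unproved fact in this cone), for every rational `c > 1` the promise problem
(SAT, UNSAT) Karp-reduces to `GapCVP_c` — Prop. 6 at the factor `4(⌈c⌉+1)²`, then the
transformation of Thm. 5 (`ABSS.gapSetCover_polyTimeReducible_gapCVP`), composed by
`PolyTimeReducible.trans_holds`. [cite: AroraEtAl1997, Thm. 5 (i) (p. 319) and its proof (p. 320)] -/
theorem AroraEtAl1997_thm5_gapCVP_of_prop6 (h : Literature.Computability.Complexity.AroraEtAl1997_prop6) :
    AroraEtAl1997_thm5_gapCVP := fun c hc =>
  Literature.Computability.Complexity.PromiseProblem.PolyTimeReducible.trans_holds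
    (h (ABSS.gapConst c : ℚ) (ABSS.one_lt_gapConst c)) (ABSS.gapSetCover_polyTimeReducible_gapCVP hc)


/-- **Arora–Babai–Stern–Sweedyk 1997, Thm. 5 (i) for `ℓ₂`, PROVED** (discharge of the named fact
`AroraEtAl1997_thm5_gapCVP` of `GapCVPConstNPHard.lean`): for every rational `c > 1`, (SAT, UNSAT)
Karp-reduces to `GapCVP_c` — `AroraEtAl1997_thm5_gapCVP_of_prop6` fed with the discharged Prop. 6
(`AroraEtAl1997_prop6_holds`, `GapSetCoverProofs.lean`: the PCP theorem in gap form, label cover,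
Lund–Yannakakis). [cite: AroraEtAl1997, Thm. 5 (i) (p. 319) and its proof (p. 320)] -/
theorem AroraEtAl1997_thm5_gapCVP_holds : AroraEtAl1997_thm5_gapCVP :=
  AroraEtAl1997_thm5_gapCVP_of_prop6 Literature.Computability.Complexity.AroraEtAl1997_prop6_holds

/-- **`GapCVP_c` is NP-hard for every constant `c > 1`** (Karp reductions of promise problems),
unconditionally: Thm. 5 (i) read through `SAT ∈ NP`
(`isNPHard_of_satUnsatPromise_polyTimeReducible`). [cite: AroraEtAl1997, Thm. 1, part 1 (i) (p. 318) and Thm. 5 (i) (p. 319)] -/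
theorem isNPHard_gapCVPPromise_const {c : ℚ} (hc : 1 < c) : (gapCVPPromise fun _ => (c : ℝ)).IsNPHard :=
  Literature.Computability.Complexity.isNPHard_of_satUnsatPromise_polyTimeReducible
    (AroraEtAl1997_thm5_gapCVP_holds c hc)

end Literature.Algebra.EuclideanLattices
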